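import Summits.CriticalPhenomena.PercolationContinuityZ3.Theorems.PercNearOneGluingNoHeavyLowerTailTformGluedStarPackingChampion
import Summits.CriticalPhenomena.PercolationContinuityZ3.Theorems.PercNearOneGluingNoHeavyLowerTailTformWitnessSeparatedTools
import HarnessLib

/-!
# `NoHeavyLowerTail` (stmt-CriticalPhenomena-4575) — the crux from the INFORMATIVE gluing step only

Support file (prover `prim-hp-5`, hull-port cell, T-form calculus, gen 7; `--supports stmt-CriticalPhenomena-4575`).  No definitions,
no named facts, no sorries.  The residual gluing hypothesis `hGlue` of `Theorems.noHeavyLowerTail_of_gluedChampion_open` asks, for a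
champion `q`, a fallback relay `c` and a light non-relay set `B` (`2 ≤ |B|`) — given light-star packing at champions for all non-relay
sets of all graphs with fewer positive pairs — for LSP(w, q, c, B).  Two of its cases are theorems:
* no member of `B` has a positive pair: then `|π(B)| = 0` and `q ≁ B` off a null set, and LSP is `Φ(c) ≤ Φ(q)` (`gluedSet_lsp_of_noPairs`);
* `q` is a champion of the GLUED lightness (`μ(G_a) ≤ μ(G_q)` for all `a`): `Theorems.gluedSet_lsp_of_gluedChampion` (glued star packing
  with a sub-champion reference).
Hence the crux follows from the gluing step restricted to the INFORMATIVE instances — those where some member has a positive pair and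
gluing `B` DETHRONES `q` (`μ(G_q) < μ(G_a)` for some relay `a`): `noHeavyLowerTail_of_informativeGluedChampion`.  (Seat memo
OBSERVER-SET.md §18–20: in that case the certificates REF/REF3 — per-world references over the star of a member — are the live line.)
-/

noncomputable section

namespace Summit.CriticalPhenomena.PercolationContinuityZ3.Theorems

open MeasureTheory Set Literature.Probability.LatticeModels Literature.Probability.Percolation
open scoped Classical BigOperators

variable {n : ℕ}

/-- **Isolated glued set.**  If no member of the non-relay set `B` has a positive pair, then for relays `q, c` with `Φ(c) ≤ Φ(q)`:
LSP(w, q, c, B) (off the null event that a weight-`0` pair is open, `|π(B)| = 0` and `q ≁ B`). [folklore] -/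
theorem gluedSet_lsp_of_noPairs (w : Sym2 (Fin n) → unitInterval) (A B : Finset (Fin n)) (q c : Fin n) (j : ℕ)
    (hqA : q ∈ A) (hBA : ∀ m ∈ B, m ∉ A) (hiso : ∀ y ∈ B, ∀ v, v ≠ y → w s(y, v) = 0)
    (hcq : (prodBernoulli w).real {ω : BondConfig (Fin n) | (A.filter fun z => ω ∈ openConn c z).card ≤ j} ≤
      (prodBernoulli w).real {ω : BondConfig (Fin n) | (A.filter fun z => ω ∈ openConn q z).card ≤ j}) :
    (prodBernoulli w).real {ω : BondConfig (Fin n) | (∀ m ∈ B, ω ∉ openConn q m) ∧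
        1 ≤ (A.filter fun z => ∃ m ∈ B, ω ∈ openConn m z).card ∧ (A.filter fun z => ∃ m ∈ B, ω ∈ openConn m z).card ≤ j} +
      (prodBernoulli w).real {ω : BondConfig (Fin n) | ¬ 1 ≤ (A.filter fun z => ∃ m ∈ B, ω ∈ openConn m z).card ∧
        (A.filter fun z => ω ∈ openConn c z).card ≤ j} ≤
      (prodBernoulli w).real {ω : BondConfig (Fin n) | (∀ m ∈ B, ω ∉ openConn q m) ∧ (A.filter fun z => ω ∈ openConn q z).card ≤ j} := by
  haveI : IsProbabilityMeasure (prodBernoulli w) := inferInstance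
  set μ := prodBernoulli w with hμ
  -- on the support event, no member of `B` is joined to any other vertex
  have hnoreach : ∀ ω : BondConfig (Fin n), (∀ e ∈ ω, w e ≠ 0) → ∀ m ∈ B, ∀ z, z ≠ m → ω ∉ openConn m z := by
    intro ω hω m hm z hzm hreach
    have hreach' : (openGraph ω).Reachable m z := hreach
    obtain ⟨p⟩ := hreach'
    cases p with
    | nil => exact hzm rfl
    | cons hadj tail =>
      rename_i v
      have hv : s(m, v) ∈ ω ∧ m ≠ v := (openGraph_adj ω m v).1 hadj
      exact hω _ hv.1 (hiso m hm v hv.2.symm)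
  have hNB0 : ∀ ω : BondConfig (Fin n), (∀ e ∈ ω, w e ≠ 0) → (A.filter fun z => ∃ m ∈ B, ω ∈ openConn m z).card = 0 := by
    intro ω hω
    rw [Finset.card_eq_zero, Finset.filter_eq_empty_iff]
    rintro z hz ⟨m, hm, hmz⟩
    exact hnoreach ω hω m hm z (fun h => hBA m hm (h ▸ hz)) hmz
  have hqB : ∀ ω : BondConfig (Fin n), (∀ e ∈ ω, w e ≠ 0) → ∀ m ∈ B, ω ∉ openConn q m := by
    intro ω hω m hm hqm
    have hmq : (openGraph ω).Reachable m q := (show (openGraph ω).Reachable q m from hqm).symm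
    exact hnoreach ω hω m hm q (fun h => hBA m hm (h ▸ hqA)) hmq
  have h1 : μ.real {ω : BondConfig (Fin n) | (∀ m ∈ B, ω ∉ openConn q m) ∧
      1 ≤ (A.filter fun z => ∃ m ∈ B, ω ∈ openConn m z).card ∧ (A.filter fun z => ∃ m ∈ B, ω ∈ openConn m z).card ≤ j} =
      μ.real (∅ : Set (BondConfig (Fin n))) := by
    refine WitnessSeparated.measureReal_congr_support w fun ω hω => ?_
    simp only [mem_setOf_eq, mem_empty_iff_false, iff_false, not_and]
    intro _ h1 _
    rw [hNB0 ω hω] at h1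
    omega
  have h2 : μ.real {ω : BondConfig (Fin n) | ¬ 1 ≤ (A.filter fun z => ∃ m ∈ B, ω ∈ openConn m z).card ∧
      (A.filter fun z => ω ∈ openConn c z).card ≤ j} = μ.real {ω : BondConfig (Fin n) | (A.filter fun z => ω ∈ openConn c z).card ≤ j} := by
    refine WitnessSeparated.measureReal_congr_support w fun ω hω => ?_
    simp only [mem_setOf_eq, hNB0 ω hω]
    omega
  have h3 : μ.real {ω : BondConfig (Fin n) | (∀ m ∈ B, ω ∉ openConn q m) ∧ (A.filter fun z => ω ∈ openConn q z).card ≤ j} =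
      μ.real {ω : BondConfig (Fin n) | (A.filter fun z => ω ∈ openConn q z).card ≤ j} := by
    refine WitnessSeparated.measureReal_congr_support w fun ω hω => ?_
    simp only [mem_setOf_eq]
    exact ⟨fun h => h.2, fun h => ⟨hqB ω hω, h⟩⟩
  rw [h1, h2, h3, measureReal_empty, zero_add]
  exact hcq

/-- **The crux from the INFORMATIVE gluing step.**  `NoHeavyLowerTail` follows from the gluing step of
`noHeavyLowerTail_of_gluedChampion_open` restricted to instances where some member of `B` has a positive pair and gluing `B`
dethrones the champion `q` (`μ(G_q) < μ(G_a)` for some relay `a`, `G_a` = "`a` light in `w/B`").  The other instances are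
`gluedSet_lsp_of_noPairs` and `gluedSet_lsp_of_gluedChampion`. [cite: KozmaNitzan2024, Lemma 5 (p. 13)] -/
theorem noHeavyLowerTail_of_informativeGluedChampion
    (hGlueInf : ∀ (n : ℕ) (w : Sym2 (Fin n) → unitInterval) (A B : Finset (Fin n)) (q c : Fin n) (j : ℕ),
      (∀ (n' : ℕ) (w' : Sym2 (Fin n') → unitInterval) (A' B' : Finset (Fin n')) (q' c' : Fin n') (j' : ℕ),
        ((Finset.univ.filter fun e : Sym2 (Fin n') => w' e ≠ 0).card <
            (Finset.univ.filter fun e : Sym2 (Fin n) => w e ≠ 0).card ∨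
          ((Finset.univ.filter fun e : Sym2 (Fin n') => w' e ≠ 0).card ≤
            (Finset.univ.filter fun e : Sym2 (Fin n) => w e ≠ 0).card ∧ B'.card < B.card)) →
        q' ∈ A' → c' ∈ A' → B'.Nonempty → (∀ y ∈ B', y ∉ A') →
        (∀ a ∈ A', (prodBernoulli w').real {ω : BondConfig (Fin n') | (A'.filter fun x => ω ∈ openConn a x).card ≤ j'} ≤
          (prodBernoulli w').real {ω : BondConfig (Fin n') | (A'.filter fun x => ω ∈ openConn q' x).card ≤ j'}) →
        (prodBernoulli w').real {ω : BondConfig (Fin n') |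
            (∀ y ∈ B', ω ∉ openConn q' y) ∧
              1 ≤ (A'.filter fun z => ∃ y ∈ B', ω ∈ openConn y z).card ∧
              (A'.filter fun z => ∃ y ∈ B', ω ∈ openConn y z).card ≤ j'} +
          (prodBernoulli w').real {ω : BondConfig (Fin n') |
            ¬ 1 ≤ (A'.filter fun z => ∃ y ∈ B', ω ∈ openConn y z).card ∧
              (A'.filter fun z => ω ∈ openConn c' z).card ≤ j'} ≤
        (prodBernoulli w').real {ω : BondConfig (Fin n') |
            (∀ y ∈ B', ω ∉ openConn q' y) ∧ (A'.filter fun z => ω ∈ openConn q' z).card ≤ j'}) →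
      q ∈ A → c ∈ A → 2 ≤ B.card → (∀ y ∈ B, y ∉ A) →
      (∀ a ∈ A, (prodBernoulli w).real {ω : BondConfig (Fin n) | (A.filter fun x => ω ∈ openConn a x).card ≤ j} ≤
        (prodBernoulli w).real {ω : BondConfig (Fin n) | (A.filter fun x => ω ∈ openConn q x).card ≤ j}) →
      (∀ y ∈ B, (prodBernoulli w).real {ω : BondConfig (Fin n) | (A.filter fun x => ω ∈ openConn q x).card ≤ j} <
        (prodBernoulli w).real {ω : BondConfig (Fin n) | (A.filter fun x => ω ∈ openConn y x).card ≤ j}) →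
      (∃ y ∈ B, ∃ v, v ≠ y ∧ w s(y, v) ≠ 0) →
      (∃ a ∈ A, (prodBernoulli w).real {ω : BondConfig (Fin n) |
          ((∃ m ∈ B, ω ∈ openConn q m) → (A.filter fun z => ∃ m ∈ B, ω ∈ openConn m z).card ≤ j) ∧
            ((∀ m ∈ B, ω ∉ openConn q m) → (A.filter fun z => ω ∈ openConn q z).card ≤ j)} <
        (prodBernoulli w).real {ω : BondConfig (Fin n) |
          ((∃ m ∈ B, ω ∈ openConn a m) → (A.filter fun z => ∃ m ∈ B, ω ∈ openConn m z).card ≤ j) ∧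
            ((∀ m ∈ B, ω ∉ openConn a m) → (A.filter fun z => ω ∈ openConn a z).card ≤ j)}) →
      (prodBernoulli w).real {ω : BondConfig (Fin n) |
          (∀ y ∈ B, ω ∉ openConn q y) ∧
            1 ≤ (A.filter fun z => ∃ y ∈ B, ω ∈ openConn y z).card ∧
            (A.filter fun z => ∃ y ∈ B, ω ∈ openConn y z).card ≤ j} +
        (prodBernoulli w).real {ω : BondConfig (Fin n) |
          ¬ 1 ≤ (A.filter fun z => ∃ y ∈ B, ω ∈ openConn y z).card ∧
            (A.filter fun z => ω ∈ openConn c z).card ≤ j} ≤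
      (prodBernoulli w).real {ω : BondConfig (Fin n) |
          (∀ y ∈ B, ω ∉ openConn q y) ∧ (A.filter fun z => ω ∈ openConn q z).card ≤ j}) :
    Summit.CriticalPhenomena.PercolationContinuityZ3.Theses.PercNearOneGluing.NoHeavyLowerTail := by
  refine noHeavyLowerTail_of_gluedChampion_open fun n w A B q c j ih hq hc hB hBA hch hl => ?_
  by_cases hpos : ∃ y ∈ B, ∃ v, v ≠ y ∧ w s(y, v) ≠ 0
  · by_cases hinf : ∃ a ∈ A, (prodBernoulli w).real {ω : BondConfig (Fin n) |
          ((∃ m ∈ B, ω ∈ openConn q m) → (A.filter fun z => ∃ m ∈ B, ω ∈ openConn m z).card ≤ j) ∧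
            ((∀ m ∈ B, ω ∉ openConn q m) → (A.filter fun z => ω ∈ openConn q z).card ≤ j)} <
        (prodBernoulli w).real {ω : BondConfig (Fin n) |
          ((∃ m ∈ B, ω ∈ openConn a m) → (A.filter fun z => ∃ m ∈ B, ω ∈ openConn m z).card ≤ j) ∧
            ((∀ m ∈ B, ω ∉ openConn a m) → (A.filter fun z => ω ∈ openConn a z).card ≤ j)}
    · -- the informative case: the hypothesis
      exact hGlueInf n w A B q c j ih hq hc hB hBA hch hl hpos hinf
    · -- `q` is a champion of the glued lightness: the non-informative gluing step
      push Not at hinf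
      exact gluedSet_lsp_of_gluedChampion w A B q c j
        (fun n' w' A' B' q' c' j' hlt hq' hc' hB' hBA' hch' => ih n' w' A' B' q' c' j' (Or.inl hlt) hq' hc' hB' hBA' hch')
        hq hc hBA hB hpos hinf
  · -- no member has a positive pair
    push Not at hpos
    have hiso : ∀ y ∈ B, ∀ v, v ≠ y → w s(y, v) = 0 := fun y hy v hvy => hpos y hy v hvy
    exact gluedSet_lsp_of_noPairs w A B q c j hq hBA hiso (hch c hc)

end Summit.CriticalPhenomena.PercolationContinuityZ3.Theorems

end
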